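import Literature.NumberTheory.LFunctions.ZetaArgSIntegralLowHeight
import Literature.NumberTheory.LFunctions.ZetaFirstZeroCertificate
import Literature.Analysis.SpecialFunctions.DigammaStirlingSeries
import Literature.Analysis.SpecialFunctions.DigammaVerticalSeries
import HarnessLib

/-!
# RH-FREE — The Riemann–Siegel theta function at small height: monotonicity of `θ'`, closed forms for `θ(t)` and `∫₀ᵀ θ` from the shifted Stirling series of `ψ`, and `S₁(T) = ∫₀ᵀ S` below the first zero («nothing here bears on the truth of RH»)

Topic `Literature/NumberTheory/LFunctions` (RH literature-typing tranche 1, L4 "explicit zero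
statistics", gen 8). Label: **RH-FREE**. THEOREMS only — NO definition, NO new named fact (D-0026).
Nothing here bears on the truth of RH.

Purpose: the numerical inputs behind Simonič's unconditional bound (J. Number Theory 231 (2022),
eq. (1.7) and its footnote) "`|S₁(t)| ≤ 0.059 log t + 3.054` for `t ≥ 1` … This follows from
[Trudgian 2011], and the fact that `|S₁(168π)| ≤ 0.987` and (1.7) is true for `1 ≤ t ≤ 168π`" need
`S₁(T) = ∫₀ᵀ S(u) du` — hence `∫₀ᵀ θ` — for SMALL `T`, where the Stirling bounds of the tree
(`RiemannSiegelStirling*.lean`, powers of `1/t`) are useless. Here `θ` is represented through the tree's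
**shifted Stirling series for `ψ`** (`Literature.Analysis.SpecialFunctions.Complex.norm_digamma_sub_stirlingSeries_shift_le`,
shift `J = 16`, order `ν = 2`): with `w = ¼ + iu`,
`Re ψ(w) = Re M(w) + O(3.6·10⁻⁸)`, `M(w) = Log(w+16) − Σ_{j<16}(w+j)⁻¹ − 1/(2(w+16)) − 1/(12(w+16)²)
+ 1/(120(w+16)⁴)`, uniformly in `u ≥ 0`, and `M = G'`, `G = H'` for the explicit holomorphic `G`, `H`
below, so that (`θ(t) = ∫₀^{t/2} Re ψ(¼+iu) du − (t/2) log π`):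

* `abs_riemannSiegelTheta_sub_im_G_le` — **`|θ(t) − (Im G(¼ + it/2) − (t/2) log π)| ≤ 3.6·10⁻⁸ · t/2`**
  for all `t ≥ 0`;
* `abs_integral_riemannSiegelTheta_sub_re_H_le` — **`|∫₀ᵀ θ − (−2(Re H(¼ + iT/2) − Re H(¼))
  − (log π) T²/4)| ≤ 3.6·10⁻⁸ · T²/4`** for `T ≥ 0`;
* `abs_pi_mul_integral_zetaArgS_zero_le` — **`S₁` below the first zero**: for `0 ≤ T ≤ 14`,
  `|π∫₀ᵀ S − (2(Re H(¼ + iT/2) − Re H(¼)) + (log π)T²/4 − πT)| ≤ 3.6·10⁻⁸ · T²/4` (`N(t) = 0` for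
  `t ≤ 14`: `zetaZeroCount_fourteen`);
* `abs_riemannSiegelThetaDeriv_sub_re_M_le` — `|θ'(u) − (Re M(¼ + iu/2)/2 − (log π)/2)| ≤ 1.8·10⁻⁸`;
* `monotoneOn_re_digamma_vertical`, `monotoneOn_riemannSiegelThetaDeriv` — **`u ↦ Re ψ(σ + iu)` and
  `θ'` are non-decreasing on `[0, ∞)`** (Gauss's formula `ψ(w) = lim (log n − Σ_{j≤n}(w+j)⁻¹)`, each
  `−Re (w+j)⁻¹ = −(σ+j)/((σ+j)² + u²)` non-decreasing in `u ≥ 0`), so `θ` is convex on `[0, ∞)`;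
* `abs_pi_mul_integral_zetaArgS_sub_closedForm_le_sharp` — the closed form of
  `ZetaArgSIntegralLowHeight.lean` for `π∫_b^{168π} S` with the error sharpened from `0.007` to `1.6·10⁻⁵`
  (the term `−7/(11520x²)` kept, `∫_b^∞ (0.0754/t⁵ + 0.0762/t⁷ + 50.03/t⁹) dt` in closed form).

## References

* A. Simonič, *On explicit estimates for `S(t)`, `S₁(t)`, and `ζ(1/2+it)` under the Riemann
  Hypothesis*, J. Number Theory 231 (2022) 464–491, eq. (1.7) and footnote. [Simonic2022]
* G. E. Andrews, R. Askey, R. Roy, *Special Functions* (1999), Thm 1.2.5 (Gauss's formula),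
  Cor 1.4.5 (Stirling for `ψ`). [AndrewsAskeyRoy1999]
* H. M. Edwards, *Riemann's Zeta Function* (1974), §6.5 (`ϑ(t)`). [EdwardsZeta1974]
-/

noncomputable section

open Complex Real Set Filter MeasureTheory intervalIntegral
open scoped Topology

namespace Literature.NumberTheory.LFunctions

open SchoenfeldBound Literature.Analysis.SpecialFunctions.Complex

/-! ### `u ↦ Re ψ(σ + iu)` is non-decreasing on `[0, ∞)` -/

/-- **`Re ψ(σ + iu)` is non-decreasing in `u ≥ 0`** (`σ > 0`): by Gauss's formula
`ψ(w) = lim_n (log n − Σ_{j≤n} (w+j)⁻¹)`, and `−Re (w+j)⁻¹ = −(σ+j)/((σ+j)² + u²)` is non-decreasing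
in `u ≥ 0` for each `j`. [cite: AndrewsAskeyRoy1999, Thm 1.2.5 (1.2.13)] -/
theorem monotoneOn_re_digamma_vertical {σ : ℝ} (hσ : 0 < σ) :
    MonotoneOn (fun u : ℝ ↦ (Complex.digamma (σ + u * I)).re) (Ici 0) := by
  intro u hu u' hu' huu'
  have hu0 : 0 ≤ u := hu
  have key : ∀ x : ℝ, Tendsto (fun n : ℕ ↦ Real.log n - ∑ j ∈ Finset.range (n + 1),
      (σ + j) / ((σ + j) ^ 2 + x ^ 2)) atTop (𝓝 (Complex.digamma (σ + x * I)).re) := by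
    intro x
    have hw : 0 < ((σ : ℂ) + x * I).re := by simpa using hσ
    have h := (Complex.continuous_re.tendsto _).comp (tendsto_log_sub_sum_inv_digamma hw)
    refine h.congr fun n ↦ ?_
    simp only [Function.comp_apply, Complex.sub_re, Complex.ofReal_re, Complex.re_sum]
    congr 1
    refine Finset.sum_congr rfl fun j _ ↦ ?_
    have hne : ((σ + j) ^ 2 + x ^ 2 : ℝ) ≠ 0 := by positivity
    rw [show ((σ : ℂ) + x * I + j) = ((σ + j : ℝ) : ℂ) + x * I by push_cast; ring, one_div,
      Complex.inv_re, Complex.normSq_apply]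
    simp
    ring
  refine le_of_tendsto_of_tendsto' (key u) (key u') fun n ↦ ?_
  apply sub_le_sub_left
  refine Finset.sum_le_sum fun j _ ↦ ?_
  have hσj : 0 < σ + j := by positivity
  apply div_le_div_of_nonneg_left hσj.le (by positivity)
  nlinarith

/-- **`θ'` is non-decreasing on `[0, ∞)`** (`θ'(u) = Re ψ(¼ + iu/2)/2 − (log π)/2`), i.e. `θ` is
convex there. [cite: EdwardsZeta1974, §6.5] -/
theorem monotoneOn_riemannSiegelThetaDeriv : MonotoneOn riemannSiegelThetaDeriv (Ici 0) := by
  intro u hu u' hu' huu'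
  have hu0 : 0 ≤ u := hu
  have hu'0 : (0 : ℝ) ≤ u' := hu'
  have h := monotoneOn_re_digamma_vertical (σ := 1 / 4) (by norm_num)
    (show u / 2 ∈ Ici (0 : ℝ) from Set.mem_Ici.2 (by positivity))
    (show u' / 2 ∈ Ici (0 : ℝ) from Set.mem_Ici.2 (by positivity))
    (show u / 2 ≤ u' / 2 by linarith)
  unfold riemannSiegelThetaDeriv
  have e : ∀ x : ℝ, (1 / 4 : ℂ) + x / 2 * I = ((1 / 4 : ℝ) : ℂ) + ((x / 2 : ℝ) : ℂ) * I := by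
    intro x; push_cast; ring
  rw [e u, e u']
  simp only at h
  linarith

/-- **`|θ'(u)| ≤ 2.7` on `[0, 7]`**: `θ'(0) = Re ψ(¼)/2 − (log π)/2 ≥ −2.687` (the tree's
`re_digamma_one_quarter_sub_log_pi_ge`), `θ'(7) ≤ ½ log(7/2π) + 2/7 < 0.35`, and `θ'` is monotone.
[cite: EdwardsZeta1974, §6.5] -/
theorem abs_riemannSiegelThetaDeriv_le_small {u : ℝ} (h0 : 0 ≤ u) (h7 : u ≤ 7) :
    |riemannSiegelThetaDeriv u| ≤ 2.7 := by
  have hlo : -2.7 ≤ riemannSiegelThetaDeriv 0 := by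
    have h := Literature.Analysis.SpecialFunctions.re_digamma_one_quarter_sub_log_pi_ge
    unfold riemannSiegelThetaDeriv
    simp only [Complex.ofReal_zero, zero_div, zero_mul, add_zero]
    linarith
  have hhi : riemannSiegelThetaDeriv 7 ≤ 0.35 := by
    have h := (abs_le.1 (abs_riemannSiegelThetaDeriv_sub_log_le (by norm_num : (1 : ℝ) ≤ 7))).2
    have hπ : 3.14159 < π := by linarith [Real.pi_gt_d6]
    have hlog : Real.log (7 / (2 * π)) ≤ 7 / (2 * π) - 1 := Real.log_le_sub_one_of_pos (by positivity)
    have h3 : 7 / (2 * π) < 1.115 := by rw [div_lt_iff₀ (by positivity)]; nlinarith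
    linarith
  have h1 := monotoneOn_riemannSiegelThetaDeriv (Set.mem_Ici.2 (le_refl (0 : ℝ))) (Set.mem_Ici.2 h0) h0
  have h2 := monotoneOn_riemannSiegelThetaDeriv (Set.mem_Ici.2 h0)
    (Set.mem_Ici.2 (by norm_num : (0 : ℝ) ≤ 7)) h7
  rw [abs_le]; constructor <;> linarith

/-! ### Derivatives along vertical lines -/

/-- If `G` has complex derivative `g` at `σ + iu`, then `x ↦ Im G(σ + ix)` has real derivative `Re g`
at `u` (`d/dx G(σ+ix) = i g`). [folklore] -/
private theorem hasDerivAt_im_vertical {G : ℂ → ℂ} {g : ℂ} {σ u : ℝ}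
    (hG : HasDerivAt G g (σ + u * I)) :
    HasDerivAt (fun x : ℝ ↦ (G (σ + x * I)).im) g.re u := by
  have hinner : HasDerivAt (fun z : ℂ ↦ (σ : ℂ) + z * I) I (u : ℂ) := by
    simpa using ((hasDerivAt_id (u : ℂ)).mul_const I).const_add (σ : ℂ)
  have hcomp : HasDerivAt (fun z : ℂ ↦ G ((σ : ℂ) + z * I)) (g * I) (u : ℂ) :=
    HasDerivAt.comp (u : ℂ) hG hinner
  have he : HasDerivAt (fun z : ℂ ↦ -I * G ((σ : ℂ) + z * I)) (-I * (g * I)) (u : ℂ) :=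
    hcomp.const_mul (-I)
  have h := he.real_of_complex
  have e1 : (-I * (g * I)).re = g.re := by
    have : -I * (g * I) = g := by
      rw [mul_comm g I, ← mul_assoc, neg_mul, Complex.I_mul_I, neg_neg, one_mul]
    rw [this]
  rw [e1] at h
  refine h.congr_of_eventuallyEq (Filter.Eventually.of_forall fun x ↦ ?_)
  simp [Complex.mul_re]

/-- If `H` has complex derivative `g` at `σ + iu`, then `x ↦ Re H(σ + ix)` has real derivative
`−Im g` at `u`. [folklore] -/
private theorem hasDerivAt_re_vertical {H : ℂ → ℂ} {g : ℂ} {σ u : ℝ}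
    (hH : HasDerivAt H g (σ + u * I)) :
    HasDerivAt (fun x : ℝ ↦ (H (σ + x * I)).re) (-g.im) u := by
  have hinner : HasDerivAt (fun z : ℂ ↦ (σ : ℂ) + z * I) I (u : ℂ) := by
    simpa using ((hasDerivAt_id (u : ℂ)).mul_const I).const_add (σ : ℂ)
  have hcomp : HasDerivAt (fun z : ℂ ↦ H ((σ : ℂ) + z * I)) (g * I) (u : ℂ) :=
    HasDerivAt.comp (u : ℂ) hH hinner
  have h := hcomp.real_of_complex
  have e1 : (g * I).re = -g.im := by simp [Complex.mul_re]
  rw [e1] at h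
  exact h

/-! ### The shifted Stirling main term `M`, and its primitives `G` (`G' = M`) and `H` (`H' = G`) -/

/-- `z ↦ Log(z + c)` (`c ≥ 0` real) has derivative `(w + c)⁻¹` at `Re w > 0`. [folklore] -/
private theorem hasDerivAt_log_add {w : ℂ} (hw : 0 < w.re) {c : ℝ} (hc : 0 ≤ c) :
    HasDerivAt (fun z : ℂ ↦ Complex.log (z + c)) ((w + c)⁻¹) w := by
  have hslit : w + (c : ℂ) ∈ Complex.slitPlane := by
    left; simp; linarith
  have h := ((hasDerivAt_id w).add_const (c : ℂ)).clog hslit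
  simpa using h

/-- `z ↦ (z + c) Log(z + c) − (z + c)` has derivative `Log(w + c)` at `Re w > 0`. [folklore] -/
private theorem hasDerivAt_mul_log_add {w : ℂ} (hw : 0 < w.re) {c : ℝ} (hc : 0 ≤ c) :
    HasDerivAt (fun z : ℂ ↦ (z + c) * Complex.log (z + c) - (z + c)) (Complex.log (w + c)) w := by
  have hne : w + (c : ℂ) ≠ 0 := by
    intro h; have := congrArg Complex.re h; simp at this; linarith
  have h1 := (((hasDerivAt_id w).add_const (c : ℂ)).mul (hasDerivAt_log_add hw hc)).sub
    ((hasDerivAt_id w).add_const (c : ℂ))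
  refine (show HasDerivAt _ _ w from h1).congr_deriv ?_
  simp only [id]
  field_simp
  ring

/-- `z ↦ 1/(k (z + 16)ⁿ⁺¹)` has derivative `−(n+1)/(k (w + 16)ⁿ⁺²)` at `Re w > 0` (`k ≠ 0`). [folklore] -/
private theorem hasDerivAt_inv_pow {w : ℂ} (hw : 0 < w.re) (n : ℕ) {k : ℂ} (hk : k ≠ 0) :
    HasDerivAt (fun z : ℂ ↦ 1 / (k * (z + 16) ^ (n + 1)))
      (-((n : ℂ) + 1) / (k * (w + 16) ^ (n + 2))) w := by
  have hne : w + 16 ≠ 0 := by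
    intro h; have := congrArg Complex.re h; simp at this; linarith
  have hpow := ((hasDerivAt_id w).add_const (16 : ℂ)).pow (n + 1)
  have hinv := hpow.fun_inv (pow_ne_zero (n + 1) hne)
  have h := hinv.const_mul k⁻¹
  have ef : (fun z : ℂ ↦ 1 / (k * (z + 16) ^ (n + 1))) = fun z ↦ k⁻¹ * ((id z + 16) ^ (n + 1))⁻¹ := by
    funext z; simp only [id]; rw [one_div, mul_inv]
  rw [ef]
  refine h.congr_deriv ?_
  simp only [id, mul_one, Nat.add_sub_cancel, Pi.pow_apply]
  push_cast
  field_simp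
  ring

/-- **`G' = M`**: with `M(w) = Log(w+16) − Σ_{j<16}(w+j)⁻¹ − 1/(2(w+16)) − 1/(12(w+16)²) + 1/(120(w+16)⁴)`
(the order-`2`, shift-`16` Stirling main term of `ψ`) and
`G(w) = (w+16)Log(w+16) − (w+16) − Σ_{j<16} Log(w+j) − Log(w+16)/2 + 1/(12(w+16)) − 1/(360(w+16)³)`,
`G` has derivative `M(w)` at every `w` with `Re w > 0`. [cite: AndrewsAskeyRoy1999, Cor 1.4.5 (Stirling series for ψ, integrated)] -/
theorem hasDerivAt_stirlingG {w : ℂ} (hw : 0 < w.re) :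
    HasDerivAt (fun z : ℂ ↦ (z + 16) * Complex.log (z + 16) - (z + 16)
        - ∑ j ∈ Finset.range 16, Complex.log (z + j) - Complex.log (z + 16) / 2
        + 1 / (12 * (z + 16)) - 1 / (360 * (z + 16) ^ 3))
      (Complex.log (w + 16) - ∑ j ∈ Finset.range 16, (w + j)⁻¹ - 1 / (2 * (w + 16))
        - 1 / (12 * (w + 16) ^ 2) + 1 / (120 * (w + 16) ^ 4)) w := by
  have hne : w + 16 ≠ 0 := by
    intro h; have := congrArg Complex.re h; simp at this; linarith
  have hA := hasDerivAt_mul_log_add hw (c := 16) (by norm_num)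
  have hS : HasDerivAt (fun z : ℂ ↦ ∑ j ∈ Finset.range 16, Complex.log (z + j))
      (∑ j ∈ Finset.range 16, (w + j)⁻¹) w := by
    have h := HasDerivAt.fun_sum (u := Finset.range 16)
      (A := fun (j : ℕ) (z : ℂ) ↦ Complex.log (z + j)) (A' := fun j ↦ (w + (j : ℂ))⁻¹) (x := w)
      (fun j _ ↦ by
        have := hasDerivAt_log_add hw (c := (j : ℝ)) (Nat.cast_nonneg j)
        simpa using this)
    simpa using h
  have hB : HasDerivAt (fun z : ℂ ↦ Complex.log (z + 16) / 2) (1 / (2 * (w + 16))) w := by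
    have := (hasDerivAt_log_add hw (c := 16) (by norm_num)).div_const 2
    refine (by simpa using this : HasDerivAt (fun z : ℂ ↦ Complex.log (z + 16) / 2)
      ((w + 16)⁻¹ / 2) w).congr_deriv ?_
    field_simp
  have hC := hasDerivAt_inv_pow hw 0 (k := 12) (by norm_num)
  have hD := hasDerivAt_inv_pow hw 2 (k := 360) (by norm_num)
  have h := (((hA.sub hS).sub hB).add hC).sub hD
  have hA' : (fun z : ℂ ↦ (z + 16) * Complex.log (z + 16) - (z + 16)
        - ∑ j ∈ Finset.range 16, Complex.log (z + j) - Complex.log (z + 16) / 2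
        + 1 / (12 * (z + 16)) - 1 / (360 * (z + 16) ^ 3)) =
      fun z ↦ ((z + (16 : ℝ)) * Complex.log (z + (16 : ℝ)) - (z + (16 : ℝ)))
        - ∑ j ∈ Finset.range 16, Complex.log (z + j) - Complex.log (z + 16) / 2
        + 1 / (12 * (z + 16) ^ (0 + 1)) - 1 / (360 * (z + 16) ^ (2 + 1)) := by
    funext z; push_cast; ring
  rw [hA']
  refine h.congr_deriv ?_
  push_cast
  field_simp
  ring

/-- **`H' = G`**: with
`H(w) = (w+16)²/2 · Log(w+16) − 3(w+16)²/4 − Σ_{j<16}((w+j)Log(w+j) − (w+j)) − ((w+16)Log(w+16) − (w+16))/2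
+ Log(w+16)/12 + 1/(720(w+16)²)`, `H` has derivative `G(w)` at every `w` with `Re w > 0`.
[cite: AndrewsAskeyRoy1999, Cor 1.4.5 (Stirling series for ψ, integrated twice)] -/
theorem hasDerivAt_stirlingH {w : ℂ} (hw : 0 < w.re) :
    HasDerivAt (fun z : ℂ ↦ (z + 16) ^ 2 / 2 * Complex.log (z + 16) - 3 * (z + 16) ^ 2 / 4
        - ∑ j ∈ Finset.range 16, ((z + j) * Complex.log (z + j) - (z + j))
        - ((z + 16) * Complex.log (z + 16) - (z + 16)) / 2
        + Complex.log (z + 16) / 12 + 1 / (720 * (z + 16) ^ 2))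
      ((w + 16) * Complex.log (w + 16) - (w + 16)
        - ∑ j ∈ Finset.range 16, Complex.log (w + j) - Complex.log (w + 16) / 2
        + 1 / (12 * (w + 16)) - 1 / (360 * (w + 16) ^ 3)) w := by
  have hne : w + 16 ≠ 0 := by
    intro h; have := congrArg Complex.re h; simp at this; linarith
  have hL := hasDerivAt_log_add hw (c := 16) (by norm_num)
  have hP : HasDerivAt (fun z : ℂ ↦ (z + (16 : ℝ)) ^ 2 / 2) (2 * (w + (16 : ℝ)) / 2) w := by
    have := (((hasDerivAt_id w).add_const ((16 : ℝ) : ℂ)).pow 2).div_const 2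
    simpa using this
  have h1 : HasDerivAt (fun z : ℂ ↦ (z + (16 : ℝ)) ^ 2 / 2 * Complex.log (z + (16 : ℝ)))
      (2 * (w + (16 : ℝ)) / 2 * Complex.log (w + (16 : ℝ)) + (w + (16 : ℝ)) ^ 2 / 2 * (w + (16 : ℝ))⁻¹) w :=
    hP.mul hL
  have h2 : HasDerivAt (fun z : ℂ ↦ 3 * (z + (16 : ℝ)) ^ 2 / 4) (3 * (2 * (w + (16 : ℝ))) / 4) w := by
    have := ((((hasDerivAt_id w).add_const ((16 : ℝ) : ℂ)).pow 2).const_mul 3).div_const 4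
    simpa using this
  have hS : HasDerivAt (fun z : ℂ ↦ ∑ j ∈ Finset.range 16, ((z + j) * Complex.log (z + j) - (z + j)))
      (∑ j ∈ Finset.range 16, Complex.log (w + j)) w := by
    have h := HasDerivAt.fun_sum (u := Finset.range 16)
      (A := fun (j : ℕ) (z : ℂ) ↦ (z + j) * Complex.log (z + j) - (z + j))
      (A' := fun j ↦ Complex.log (w + (j : ℂ))) (x := w)
      (fun j _ ↦ by
        have := hasDerivAt_mul_log_add hw (c := (j : ℝ)) (Nat.cast_nonneg j)
        simpa using this)
    simpa using h
  have h3 := (hasDerivAt_mul_log_add hw (c := 16) (by norm_num)).div_const 2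
  have h4 := hL.div_const 12
  have h5 := hasDerivAt_inv_pow hw 1 (k := 720) (by norm_num)
  have h := ((((h1.sub h2).sub hS).sub h3).add h4).add h5
  have hH' : (fun z : ℂ ↦ (z + 16) ^ 2 / 2 * Complex.log (z + 16) - 3 * (z + 16) ^ 2 / 4
        - ∑ j ∈ Finset.range 16, ((z + j) * Complex.log (z + j) - (z + j))
        - ((z + 16) * Complex.log (z + 16) - (z + 16)) / 2
        + Complex.log (z + 16) / 12 + 1 / (720 * (z + 16) ^ 2)) =
      fun z ↦ (z + (16 : ℝ)) ^ 2 / 2 * Complex.log (z + (16 : ℝ)) - 3 * (z + (16 : ℝ)) ^ 2 / 4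
        - ∑ j ∈ Finset.range 16, ((z + j) * Complex.log (z + j) - (z + j))
        - ((z + (16 : ℝ)) * Complex.log (z + (16 : ℝ)) - (z + (16 : ℝ))) / 2
        + Complex.log (z + (16 : ℝ)) / 12 + 1 / (720 * (z + 16) ^ (1 + 1)) := by
    funext z; push_cast; ring
  rw [hH']
  refine h.congr_deriv ?_
  push_cast
  field_simp
  ring

/-! ### The Stirling remainder at `w = ¼ + iu`, shift `16`, order `2` -/

/-- `Finset.Icc 1 2`-sum of the Bernoulli terms: `B₂/(2(w+16)²) + B₄/(4(w+16)⁴) = 1/(12(w+16)²) − 1/(120(w+16)⁴)`.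
[folklore] -/
private theorem bernoulli_sum_two {w : ℂ} (hw : w + 16 ≠ 0) :
    ∑ k ∈ Finset.Icc 1 2, (bernoulli (2 * k) : ℂ) / (2 * k) / (w + 16) ^ (2 * k) =
      1 / (12 * (w + 16) ^ 2) - 1 / (120 * (w + 16) ^ 4) := by
  rw [show Finset.Icc 1 2 = {1, 2} by rfl, Finset.sum_pair (by norm_num)]
  have h2 : bernoulli 2 = 1 / 6 := by
    rw [bernoulli_eq_bernoulli'_of_ne_one (by norm_num), bernoulli'_two]
  have h4 : bernoulli 4 = -1 / 30 := by
    rw [bernoulli_eq_bernoulli'_of_ne_one (by norm_num), bernoulli'_four]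
  simp only [Nat.mul_one, show 2 * 2 = 4 by rfl, h2, h4]
  push_cast
  field_simp
  ring

/-- **The shifted Stirling remainder is `≤ 3.6·10⁻⁸` on the line `Re w = ¼`**: for every real `u`,
`‖ψ(¼ + iu) − M(¼ + iu)‖ ≤ 3.6·10⁻⁸` (`J = 16`, `ν = 2`: `(π²/3)·5!/(2π)⁵/16.25⁵ = 3.56·10⁻⁸`).
[cite: AndrewsAskeyRoy1999, Cor 1.4.5 (Stirling for ψ)] -/
theorem norm_digamma_quarter_sub_stirlingM_le (u : ℝ) :
    ‖Complex.digamma (1 / 4 + u * I) - (Complex.log ((1 / 4 + u * I) + 16)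
        - ∑ j ∈ Finset.range 16, ((1 / 4 + u * I) + j)⁻¹ - 1 / (2 * ((1 / 4 + u * I) + 16))
        - 1 / (12 * ((1 / 4 + u * I) + 16) ^ 2) + 1 / (120 * ((1 / 4 + u * I) + 16) ^ 4))‖ ≤ 3.6e-8 := by
  set w : ℂ := 1 / 4 + u * I with hw
  have hre : w.re = 1 / 4 := by simp [hw]
  have hw0 : 0 < w.re := by rw [hre]; norm_num
  have hne : w + 16 ≠ 0 := by
    intro h; have := congrArg Complex.re h; simp [hw] at this; norm_num at this
  have h := norm_digamma_sub_stirlingSeries_shift_le hw0 16 (ν := 2) two_ne_zero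
  simp only [Nat.cast_ofNat] at h
  rw [bernoulli_sum_two hne, hre] at h
  have e : Complex.log (w + 16) - ∑ j ∈ Finset.range 16, (w + j)⁻¹ - 1 / (2 * (w + 16))
      - (1 / (12 * (w + 16) ^ 2) - 1 / (120 * (w + 16) ^ 4)) =
      Complex.log (w + 16) - ∑ j ∈ Finset.range 16, (w + j)⁻¹ - 1 / (2 * (w + 16))
        - 1 / (12 * (w + 16) ^ 2) + 1 / (120 * (w + 16) ^ 4) := by ring
  rw [e] at h
  refine h.trans ?_
  -- `‖w + 16‖ ≥ 16.25`
  have hnorm : (65 / 4 : ℝ) ≤ ‖w + 16‖ := by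
    have := Complex.abs_re_le_norm (w + 16)
    have hre' : (w + 16).re = 65 / 4 := by simp [hw]; norm_num
    rw [hre', abs_of_pos (by norm_num)] at this
    exact this
  have hπ3 : 3.14159 < π := by linarith [Real.pi_gt_d6]
  have hπ4 : π < 3.1416 := by linarith [Real.pi_lt_d4]
  have h5 : (6.28318 : ℝ) ^ 5 ≤ (2 * π) ^ 5 := pow_le_pow_left₀ (by norm_num) (by linarith) 5
  have hn4 : (65 / 4 : ℝ) ^ 4 ≤ ‖w + 16‖ ^ 4 := pow_le_pow_left₀ (by norm_num) hnorm 4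
  have hfac : ((2 * 2 + 1).factorial : ℝ) = 120 := by norm_num [Nat.factorial]
  rw [hfac, show 2 * 2 + 1 = 5 by rfl, show 2 * 2 = 4 by rfl]
  have hπ2 : π ^ 2 ≤ 3.1416 ^ 2 := pow_le_pow_left₀ Real.pi_pos.le hπ4.le 2
  calc π ^ 2 / 3 * 120 / (2 * π) ^ 5 / (‖w + 16‖ ^ 4 * (1 / 4 + 16))
      ≤ 3.1416 ^ 2 / 3 * 120 / (6.28318 : ℝ) ^ 5 / ((65 / 4 : ℝ) ^ 4 * (1 / 4 + 16)) := by
        gcongr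
    _ ≤ 3.6e-8 := by norm_num

/-- Hence **`|Re ψ(¼ + iu) − Re M(¼ + iu)| ≤ 3.6·10⁻⁸`**. [cite: AndrewsAskeyRoy1999, Cor 1.4.5] -/
theorem abs_re_digamma_quarter_sub_re_stirlingM_le (u : ℝ) :
    |(Complex.digamma (1 / 4 + u * I)).re - (Complex.log ((1 / 4 + u * I) + 16)
        - ∑ j ∈ Finset.range 16, ((1 / 4 + u * I) + j)⁻¹ - 1 / (2 * ((1 / 4 + u * I) + 16))
        - 1 / (12 * ((1 / 4 + u * I) + 16) ^ 2) + 1 / (120 * ((1 / 4 + u * I) + 16) ^ 4)).re| ≤ 3.6e-8 := by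
  rw [← Complex.sub_re]
  exact (Complex.abs_re_le_norm _).trans (norm_digamma_quarter_sub_stirlingM_le u)

/-- `M` has a complex derivative at every `w` with `Re w > 0` (value irrelevant here). [folklore] -/
private theorem differentiableAt_stirlingM {w : ℂ} (hw : 0 < w.re) :
    DifferentiableAt ℂ (fun z : ℂ ↦ Complex.log (z + 16) - ∑ j ∈ Finset.range 16, (z + j)⁻¹
      - 1 / (2 * (z + 16)) - 1 / (12 * (z + 16) ^ 2) + 1 / (120 * (z + 16) ^ 4)) w := by
  have hne : ∀ {c : ℝ}, 0 ≤ c → w + c ≠ 0 := by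
    intro c hc h; have := congrArg Complex.re h; simp at this; linarith
  have h1 := hasDerivAt_log_add hw (c := 16) (by norm_num)
  have h2 : HasDerivAt (fun z : ℂ ↦ ∑ j ∈ Finset.range 16, (z + j)⁻¹)
      (∑ j ∈ Finset.range 16, -(1 : ℂ) / (w + j) ^ 2) w := by
    refine HasDerivAt.fun_sum fun j _ ↦ ?_
    have := ((hasDerivAt_id w).add_const (j : ℂ)).fun_inv (by
      have := hne (Nat.cast_nonneg j); simpa using this)
    simpa using this
  have h3 := hasDerivAt_inv_pow hw 0 (k := 2) (by norm_num)
  have h4 := hasDerivAt_inv_pow hw 1 (k := 12) (by norm_num)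
  have h5 := hasDerivAt_inv_pow hw 3 (k := 120) (by norm_num)
  have h := ((((h1.sub h2).sub h3).sub h4).add h5).differentiableAt
  have ef : (fun z : ℂ ↦ Complex.log (z + 16) - ∑ j ∈ Finset.range 16, (z + j)⁻¹
      - 1 / (2 * (z + 16)) - 1 / (12 * (z + 16) ^ 2) + 1 / (120 * (z + 16) ^ 4)) =
      fun z ↦ Complex.log (z + (16 : ℝ)) - ∑ j ∈ Finset.range 16, (z + j)⁻¹
      - 1 / (2 * (z + 16) ^ (0 + 1)) - 1 / (12 * (z + 16) ^ (1 + 1)) + 1 / (120 * (z + 16) ^ (3 + 1)) := by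
    funext z; push_cast; ring
  rw [ef]
  exact h

/-- `u ↦ Re M(¼ + iu)` is continuous (`M` is differentiable on `Re w > 0`). [folklore] -/
private theorem continuous_re_stirlingM_vertical :
    Continuous fun u : ℝ ↦ (Complex.log (((1 / 4 : ℝ) : ℂ) + u * I + 16)
        - ∑ j ∈ Finset.range 16, (((1 / 4 : ℝ) : ℂ) + u * I + j)⁻¹ - 1 / (2 * (((1 / 4 : ℝ) : ℂ) + u * I + 16))
        - 1 / (12 * (((1 / 4 : ℝ) : ℂ) + u * I + 16) ^ 2) + 1 / (120 * (((1 / 4 : ℝ) : ℂ) + u * I + 16) ^ 4)).re := by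
  have hpath : Continuous fun u : ℝ ↦ ((1 / 4 : ℝ) : ℂ) + u * I := by fun_prop
  refine continuous_iff_continuousAt.2 fun u ↦ ?_
  have hw0 : 0 < (((1 / 4 : ℝ) : ℂ) + u * I).re := by simp
  have hc := ((differentiableAt_stirlingM hw0).continuousAt).comp
    (f := fun u : ℝ ↦ ((1 / 4 : ℝ) : ℂ) + u * I) hpath.continuousAt
  exact Complex.continuous_re.continuousAt.comp hc

/-! ### `G` and `H` at the real base point `¼` -/

/-- `Log(r + c)` is real for `r + c > 0`. [folklore] -/
private theorem log_ofReal_add {r c : ℝ} (h : 0 < r + c) :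
    Complex.log ((r : ℂ) + c) = ((Real.log (r + c) : ℝ) : ℂ) := by
  rw [Complex.ofReal_log h.le]; push_cast; rfl

/-- **`G(¼)` is real**: `Im G(¼) = 0`. [folklore] -/
private theorem im_stirlingG_quarter :
    ((fun z : ℂ ↦ (z + 16) * Complex.log (z + 16) - (z + 16)
        - ∑ j ∈ Finset.range 16, Complex.log (z + j) - Complex.log (z + 16) / 2
        + 1 / (12 * (z + 16)) - 1 / (360 * (z + 16) ^ 3)) ((1 / 4 : ℝ) : ℂ)).im = 0 := by
  have h16 : Complex.log (((1 / 4 : ℝ) : ℂ) + 16) = ((Real.log (1 / 4 + 16) : ℝ) : ℂ) := by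
    have := log_ofReal_add (r := 1 / 4) (c := 16) (by norm_num); push_cast at this ⊢; exact this
  have hj : ∀ j : ℕ, Complex.log (((1 / 4 : ℝ) : ℂ) + j) = ((Real.log (1 / 4 + j) : ℝ) : ℂ) := by
    intro j
    have := log_ofReal_add (r := 1 / 4) (c := (j : ℝ)) (by positivity); push_cast at this ⊢; exact this
  simp only [h16, hj]
  norm_cast

/-- **`Re H(¼)` in real terms**:
`Re H(¼) = 16.25²/2 · log 16.25 − 3·16.25²/4 − Σ_{j<16}((¼+j)log(¼+j) − (¼+j)) − (16.25 log 16.25 − 16.25)/2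
+ (log 16.25)/12 + 1/(720·16.25²)`. [cite: AndrewsAskeyRoy1999, Cor 1.4.5 (Stirling series for ψ, integrated twice)] -/
theorem re_stirlingH_quarter :
    ((fun z : ℂ ↦ (z + 16) ^ 2 / 2 * Complex.log (z + 16) - 3 * (z + 16) ^ 2 / 4
        - ∑ j ∈ Finset.range 16, ((z + j) * Complex.log (z + j) - (z + j))
        - ((z + 16) * Complex.log (z + 16) - (z + 16)) / 2
        + Complex.log (z + 16) / 12 + 1 / (720 * (z + 16) ^ 2)) ((1 / 4 : ℝ) : ℂ)).re =
      (1 / 4 + 16) ^ 2 / 2 * Real.log (1 / 4 + 16) - 3 * (1 / 4 + 16) ^ 2 / 4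
        - ∑ j ∈ Finset.range 16, ((1 / 4 + j) * Real.log (1 / 4 + j) - (1 / 4 + j))
        - ((1 / 4 + 16) * Real.log (1 / 4 + 16) - (1 / 4 + 16)) / 2
        + Real.log (1 / 4 + 16) / 12 + 1 / (720 * (1 / 4 + 16) ^ 2) := by
  have h16 : Complex.log (((1 / 4 : ℝ) : ℂ) + 16) = ((Real.log (1 / 4 + 16) : ℝ) : ℂ) := by
    have := log_ofReal_add (r := 1 / 4) (c := 16) (by norm_num); push_cast at this ⊢; exact this
  have hj : ∀ j : ℕ, Complex.log (((1 / 4 : ℝ) : ℂ) + j) = ((Real.log (1 / 4 + j) : ℝ) : ℂ) := by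
    intro j
    have := log_ofReal_add (r := 1 / 4) (c := (j : ℝ)) (by positivity); push_cast at this ⊢; exact this
  simp only [h16, hj]
  norm_cast

/-! ### `argGammaVert ¼`, `θ`, `θ'`, `∫θ` in closed form -/

/-- **`|argGammaVert ¼ τ − Im G(¼ + iτ)| ≤ 3.6·10⁻⁸ |τ|`** (FTC for `∫₀^τ Re M(¼+iu) du = Im G(¼+iτ) − Im G(¼)`,
`Im G(¼) = 0`, plus the Stirling remainder). [cite: AndrewsAskeyRoy1999, Cor 1.4.5] -/
theorem abs_argGammaVert_quarter_sub_im_stirlingG_le (τ : ℝ) :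
    |argGammaVert (1 / 4) τ - ((fun z : ℂ ↦ (z + 16) * Complex.log (z + 16) - (z + 16)
        - ∑ j ∈ Finset.range 16, Complex.log (z + j) - Complex.log (z + 16) / 2
        + 1 / (12 * (z + 16)) - 1 / (360 * (z + 16) ^ 3)) (((1 / 4 : ℝ) : ℂ) + τ * I)).im| ≤
      3.6e-8 * |τ| := by
  set G : ℂ → ℂ := fun z ↦ (z + 16) * Complex.log (z + 16) - (z + 16)
        - ∑ j ∈ Finset.range 16, Complex.log (z + j) - Complex.log (z + 16) / 2
        + 1 / (12 * (z + 16)) - 1 / (360 * (z + 16) ^ 3) with hG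
  set M : ℂ → ℂ := fun z ↦ Complex.log (z + 16) - ∑ j ∈ Finset.range 16, (z + j)⁻¹
      - 1 / (2 * (z + 16)) - 1 / (12 * (z + 16) ^ 2) + 1 / (120 * (z + 16) ^ 4) with hM
  have hσ : (0 : ℝ) < 1 / 4 := by norm_num
  -- the primitive of `Re M` along the line
  have hderiv : ∀ u : ℝ, HasDerivAt (fun x : ℝ ↦ (G (((1 / 4 : ℝ) : ℂ) + x * I)).im)
      (M (((1 / 4 : ℝ) : ℂ) + u * I)).re u := by
    intro u
    have hw : 0 < ((((1 / 4 : ℝ) : ℂ) + u * I)).re := by simp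
    exact hasDerivAt_im_vertical (hasDerivAt_stirlingG hw)
  have hcontM : Continuous fun u : ℝ ↦ (M (((1 / 4 : ℝ) : ℂ) + u * I)).re :=
    continuous_re_stirlingM_vertical
  have hcontψ : Continuous fun u : ℝ ↦ (Complex.digamma (((1 / 4 : ℝ) : ℂ) + u * I)).re :=
    continuous_re_digamma_vertical hσ
  have hFTC : ∫ u in (0 : ℝ)..τ, (M (((1 / 4 : ℝ) : ℂ) + u * I)).re =
      (G (((1 / 4 : ℝ) : ℂ) + τ * I)).im - (G (((1 / 4 : ℝ) : ℂ) + (0 : ℝ) * I)).im :=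
    intervalIntegral.integral_eq_sub_of_hasDerivAt (fun u _ ↦ hderiv u) (hcontM.intervalIntegrable _ _)
  have h0 : (G (((1 / 4 : ℝ) : ℂ) + (0 : ℝ) * I)).im = 0 := by
    simp only [Complex.ofReal_zero, zero_mul, add_zero]
    exact im_stirlingG_quarter
  rw [h0, sub_zero] at hFTC
  -- the remainder
  have herr : |∫ u in (0 : ℝ)..τ, ((Complex.digamma (((1 / 4 : ℝ) : ℂ) + u * I)).re
      - (M (((1 / 4 : ℝ) : ℂ) + u * I)).re)| ≤ 3.6e-8 * |τ - 0| := by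
    have h := intervalIntegral.norm_integral_le_of_norm_le_const (a := (0 : ℝ)) (b := τ) (C := 3.6e-8)
      (f := fun u ↦ (Complex.digamma (((1 / 4 : ℝ) : ℂ) + u * I)).re - (M (((1 / 4 : ℝ) : ℂ) + u * I)).re)
      (fun u _ ↦ by
        rw [Real.norm_eq_abs]
        have := abs_re_digamma_quarter_sub_re_stirlingM_le u
        push_cast at this ⊢
        exact this)
    rwa [Real.norm_eq_abs] at h
  rw [sub_zero] at herr
  -- assemble
  have hi2 : IntervalIntegrable (fun u : ℝ ↦ (Complex.digamma (((1 / 4 : ℝ) : ℂ) + u * I)).re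
      - (M (((1 / 4 : ℝ) : ℂ) + u * I)).re) volume 0 τ :=
    (hcontψ.sub hcontM).intervalIntegrable 0 τ
  have hsplit : argGammaVert (1 / 4) τ = (∫ u in (0 : ℝ)..τ, (M (((1 / 4 : ℝ) : ℂ) + u * I)).re)
      + ∫ u in (0 : ℝ)..τ, ((Complex.digamma (((1 / 4 : ℝ) : ℂ) + u * I)).re
        - (M (((1 / 4 : ℝ) : ℂ) + u * I)).re) := by
    rw [← intervalIntegral.integral_add (hcontM.intervalIntegrable _ _) hi2]
    simp only [argGammaVert, add_sub_cancel]
  rw [hsplit, hFTC]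
  convert herr using 2
  ring

/-- **`θ` at small height**: for every `t ≥ 0`,
`|θ(t) − (Im G(¼ + it/2) − (t/2) log π)| ≤ 3.6·10⁻⁸ · t/2`. [cite: EdwardsZeta1974, §6.5] -/
theorem abs_riemannSiegelTheta_sub_im_stirlingG_le {t : ℝ} (ht : 0 ≤ t) :
    |riemannSiegelTheta t - (((fun z : ℂ ↦ (z + 16) * Complex.log (z + 16) - (z + 16)
        - ∑ j ∈ Finset.range 16, Complex.log (z + j) - Complex.log (z + 16) / 2
        + 1 / (12 * (z + 16)) - 1 / (360 * (z + 16) ^ 3)) (((1 / 4 : ℝ) : ℂ) + (t / 2 : ℝ) * I)).im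
        - t / 2 * Real.log π)| ≤ 3.6e-8 * (t / 2) := by
  have h := abs_argGammaVert_quarter_sub_im_stirlingG_le (t / 2)
  rw [abs_of_nonneg (by linarith : 0 ≤ t / 2)] at h
  rw [riemannSiegelTheta_eq_argGammaVert]
  convert h using 2
  ring

/-- **`θ'` at small height**: for every real `u`,
`|θ'(u) − (Re M(¼ + iu/2)/2 − (log π)/2)| ≤ 1.8·10⁻⁸`. [cite: EdwardsZeta1974, §6.5] -/
theorem abs_riemannSiegelThetaDeriv_sub_re_stirlingM_le (u : ℝ) :
    |riemannSiegelThetaDeriv u - (((fun z : ℂ ↦ Complex.log (z + 16) - ∑ j ∈ Finset.range 16, (z + j)⁻¹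
      - 1 / (2 * (z + 16)) - 1 / (12 * (z + 16) ^ 2) + 1 / (120 * (z + 16) ^ 4))
        ((1 / 4 : ℂ) + (u / 2 : ℝ) * I)).re / 2 - Real.log π / 2)| ≤ 1.8e-8 := by
  have h := abs_re_digamma_quarter_sub_re_stirlingM_le (u / 2)
  unfold riemannSiegelThetaDeriv
  have e : (1 / 4 : ℂ) + (u : ℂ) / 2 * I = (1 / 4 : ℂ) + ((u / 2 : ℝ) : ℂ) * I := by push_cast; ring
  rw [e]
  rw [abs_le] at h ⊢
  constructor <;> linarith [h.1, h.2]

/-- **`∫₀ᵀ θ` at small height**: for every `T ≥ 0`,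
`|∫₀ᵀ θ − (−2(Re H(¼ + iT/2) − Re H(¼)) − (log π)T²/4)| ≤ 3.6·10⁻⁸ · T²/4`
(`d/dt[−2 Re H(¼ + it/2)] = Im G(¼ + it/2)`). [cite: EdwardsZeta1974, §6.5] -/
theorem abs_integral_riemannSiegelTheta_sub_re_stirlingH_le {T : ℝ} (hT : 0 ≤ T) :
    |(∫ t in (0 : ℝ)..T, riemannSiegelTheta t)
      - (-2 * (((fun z : ℂ ↦ (z + 16) ^ 2 / 2 * Complex.log (z + 16) - 3 * (z + 16) ^ 2 / 4
          - ∑ j ∈ Finset.range 16, ((z + j) * Complex.log (z + j) - (z + j))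
          - ((z + 16) * Complex.log (z + 16) - (z + 16)) / 2
          + Complex.log (z + 16) / 12 + 1 / (720 * (z + 16) ^ 2)) (((1 / 4 : ℝ) : ℂ) + (T / 2 : ℝ) * I)).re
          - ((fun z : ℂ ↦ (z + 16) ^ 2 / 2 * Complex.log (z + 16) - 3 * (z + 16) ^ 2 / 4
          - ∑ j ∈ Finset.range 16, ((z + j) * Complex.log (z + j) - (z + j))
          - ((z + 16) * Complex.log (z + 16) - (z + 16)) / 2
          + Complex.log (z + 16) / 12 + 1 / (720 * (z + 16) ^ 2)) ((1 / 4 : ℝ) : ℂ)).re)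
        - Real.log π * T ^ 2 / 4)| ≤ 3.6e-8 * T ^ 2 / 4 := by
  set G : ℂ → ℂ := fun z ↦ (z + 16) * Complex.log (z + 16) - (z + 16)
        - ∑ j ∈ Finset.range 16, Complex.log (z + j) - Complex.log (z + 16) / 2
        + 1 / (12 * (z + 16)) - 1 / (360 * (z + 16) ^ 3) with hG
  set H : ℂ → ℂ := fun z ↦ (z + 16) ^ 2 / 2 * Complex.log (z + 16) - 3 * (z + 16) ^ 2 / 4
          - ∑ j ∈ Finset.range 16, ((z + j) * Complex.log (z + j) - (z + j))
          - ((z + 16) * Complex.log (z + 16) - (z + 16)) / 2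
          + Complex.log (z + 16) / 12 + 1 / (720 * (z + 16) ^ 2) with hH
  -- the main part and its primitive
  set main : ℝ → ℝ := fun t ↦ (G (((1 / 4 : ℝ) : ℂ) + (t / 2 : ℝ) * I)).im - t / 2 * Real.log π with hmain
  set P : ℝ → ℝ := fun t ↦ -2 * (H (((1 / 4 : ℝ) : ℂ) + (t / 2 : ℝ) * I)).re - Real.log π * t ^ 2 / 4
    with hP
  have hderiv : ∀ t : ℝ, HasDerivAt P (main t) t := by
    intro t
    have hw : 0 < ((((1 / 4 : ℝ) : ℂ) + (t / 2 : ℝ) * I)).re := by simp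
    have h1 := hasDerivAt_re_vertical (hasDerivAt_stirlingH hw)
    -- compose with `t ↦ t/2`
    have h2 : HasDerivAt (fun t : ℝ ↦ (H (((1 / 4 : ℝ) : ℂ) + ((t / 2 : ℝ) : ℂ) * I)).re)
        (-(G (((1 / 4 : ℝ) : ℂ) + (t / 2 : ℝ) * I)).im * (1 / 2)) t := by
      have hh : HasDerivAt (fun t : ℝ ↦ t / 2) (1 / 2) t := by
        simpa using (hasDerivAt_id t).div_const (2 : ℝ)
      exact HasDerivAt.comp t h1 hh
    have h3 : HasDerivAt (fun t : ℝ ↦ Real.log π * t ^ 2 / 4) (Real.log π * (2 * t) / 4) t := by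
      have := ((hasDerivAt_pow 2 t).const_mul (Real.log π)).div_const 4
      simpa using this
    have h := (h2.const_mul (-2)).sub h3
    refine h.congr_deriv ?_
    simp only [hmain]
    ring
  have hcontG : Continuous fun t : ℝ ↦ (G (((1 / 4 : ℝ) : ℂ) + (t / 2 : ℝ) * I)).im := by
    have hpath : Continuous fun t : ℝ ↦ ((1 / 4 : ℝ) : ℂ) + ((t / 2 : ℝ) : ℂ) * I := by fun_prop
    refine continuous_iff_continuousAt.2 fun t ↦ ?_
    have hw : 0 < ((((1 / 4 : ℝ) : ℂ) + (t / 2 : ℝ) * I)).re := by simp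
    have hc := ((hasDerivAt_stirlingG hw).differentiableAt.continuousAt).comp
      (f := fun t : ℝ ↦ ((1 / 4 : ℝ) : ℂ) + ((t / 2 : ℝ) : ℂ) * I) hpath.continuousAt
    exact Complex.continuous_im.continuousAt.comp hc
  have hcont_main : Continuous main := hcontG.sub (by fun_prop)
  have hFTC : ∫ t in (0 : ℝ)..T, main t = P T - P 0 :=
    intervalIntegral.integral_eq_sub_of_hasDerivAt (fun t _ ↦ hderiv t) (hcont_main.intervalIntegrable _ _)
  -- the remainder
  have herr : |∫ t in (0 : ℝ)..T, (riemannSiegelTheta t - main t)| ≤ 3.6e-8 * T ^ 2 / 4 := by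
    have h := intervalIntegral.norm_integral_le_of_norm_le hT
      (f := fun t ↦ riemannSiegelTheta t - main t) (g := fun t ↦ 3.6e-8 / 2 * t)
      (Filter.Eventually.of_forall fun t ht ↦ by
        rw [Real.norm_eq_abs]
        have := abs_riemannSiegelTheta_sub_im_stirlingG_le (le_of_lt ht.1)
        simp only [hmain]
        linarith)
      ((by fun_prop : Continuous fun t : ℝ ↦ 3.6e-8 / 2 * t).intervalIntegrable (μ := volume) 0 T)
    rw [Real.norm_eq_abs, intervalIntegral.integral_const_mul, integral_id] at h
    refine h.trans (le_of_eq ?_)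
    ring
  have hi2 : IntervalIntegrable (fun t : ℝ ↦ riemannSiegelTheta t - main t) volume 0 T :=
    (continuous_riemannSiegelTheta.sub hcont_main).intervalIntegrable 0 T
  have hsplit : ∫ t in (0 : ℝ)..T, riemannSiegelTheta t =
      (∫ t in (0 : ℝ)..T, main t) + ∫ t in (0 : ℝ)..T, (riemannSiegelTheta t - main t) := by
    rw [← intervalIntegral.integral_add (hcont_main.intervalIntegrable _ _) hi2]
    refine intervalIntegral.integral_congr fun t _ ↦ ?_
    ring
  rw [hsplit, hFTC]
  have hP0 : P 0 = -2 * (H ((1 / 4 : ℝ) : ℂ)).re := by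
    simp only [hP, zero_div, Complex.ofReal_zero, zero_mul, add_zero]
    ring
  rw [hP0]
  simp only [hP]
  convert herr using 2
  ring

/-- **`S₁(T) = ∫₀ᵀ S` below the first zero, in closed form**: for `0 ≤ T ≤ 14`
(`N(t) = 0` there: `zetaZeroCount_fourteen`),
`|π∫₀ᵀ S − (2(Re H(¼ + iT/2) − Re H(¼)) + (log π)T²/4 − πT)| ≤ 3.6·10⁻⁸ · T²/4`
(`πS = πN − θ − π`). [cite: Simonic2022, eq. (1.7) (footnote)] -/
theorem abs_pi_mul_integral_zetaArgS_small_le {T : ℝ} (h0 : 0 ≤ T) (h14 : T ≤ 14) :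
    |π * (∫ t in (0 : ℝ)..T, zetaArgS t)
      - (2 * (((fun z : ℂ ↦ (z + 16) ^ 2 / 2 * Complex.log (z + 16) - 3 * (z + 16) ^ 2 / 4
          - ∑ j ∈ Finset.range 16, ((z + j) * Complex.log (z + j) - (z + j))
          - ((z + 16) * Complex.log (z + 16) - (z + 16)) / 2
          + Complex.log (z + 16) / 12 + 1 / (720 * (z + 16) ^ 2)) (((1 / 4 : ℝ) : ℂ) + (T / 2 : ℝ) * I)).re
          - ((fun z : ℂ ↦ (z + 16) ^ 2 / 2 * Complex.log (z + 16) - 3 * (z + 16) ^ 2 / 4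
          - ∑ j ∈ Finset.range 16, ((z + j) * Complex.log (z + j) - (z + j))
          - ((z + 16) * Complex.log (z + 16) - (z + 16)) / 2
          + Complex.log (z + 16) / 12 + 1 / (720 * (z + 16) ^ 2)) ((1 / 4 : ℝ) : ℂ)).re)
        + Real.log π * T ^ 2 / 4 - π * T)| ≤ 3.6e-8 * T ^ 2 / 4 := by
  have h := abs_integral_riemannSiegelTheta_sub_re_stirlingH_le h0
  rw [pi_mul_integral_zetaArgS_eq_count_sub_theta]
  have hN : ∫ t in (0 : ℝ)..T, (zetaZeroCount t : ℝ) = 0 := by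
    rw [intervalIntegral.integral_congr (g := fun _ ↦ (0 : ℝ)) (fun t ht ↦ ?_)]
    · simp
    · rw [uIcc_of_le h0] at ht
      have h1 := zetaZeroCount_mono (ht.2.trans h14)
      rw [zetaZeroCount_fourteen] at h1
      simp [Nat.le_zero.1 h1]
  rw [hN, mul_zero, zero_sub, sub_zero]
  rw [abs_le] at h ⊢
  constructor <;> linarith [h.1, h.2]

end Literature.NumberTheory.LFunctions
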